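import Summits.MatrixMultiplication.OmegaCensus.SmallFormats.MatMul227GF3EnumMarginal
import Summits.MatrixMultiplication.OmegaCensus.SmallFormats.MatMul2211GF3HalfLawReduction
import HarnessLib

/-!
# ω-census family (a): the COUNT-CERTIFICATE PIPELINE for `𝔽₃` rungs of `⟨2,2,n⟩` (generic `(n, r, C)`)

Cell `pub-omega` (unit `pub-omega-tensor`, gen 35), topic `Summits/MatrixMultiplication/OmegaCensus` (sub-folder
`SmallFormats`). Framing (verbatim): lottery ticket; floor = certified bounds/negative ranges. HONEST FRAMING: bookkeeping that
packages the route of `MatMul2211GF3Rank37` (p670643: `37 ≤ R_𝔽₃(⟨2,2,11⟩)`) and `MatMul227GF3HalfLawRoute` (p671817) once and for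
all `(n, r)`: a rung `r + 1 ≤ R_𝔽₃(⟨2,2,n⟩)` follows from (a) the kernel floor `r ≤ R_𝔽₃(⟨2,2,n⟩)`, (b) an invertible-line cap `C` with
`4r ≤ 11n + 2C + 1` (so that the HALF LAW `InvertiblePointHalfLaw`, p666834, bounds the number of X-forms vanishing at any invertible
point by `C`), and (c) a CERTIFICATE that no count vector `c : ℕ → ℕ` over tensor g31's 40 classes satisfies the class-wise clauses —
J-planes (`0–31`, load `+ 3n ≤ r`), rows/columns (`32–39`, load `+ 6n ≤ 2r`), `𝔽₉`-planes (`40–57`, load `+ 3n ≤ r`), invertible lines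
(`58–81`, load `≤ C`) — and the total `tot c = r` (`succ_le_tensorRank_22n_gf3_of_count_certificate`). The bridge
`cnt_clauses` (marginal ↦ count vector) is tensor g31's `adm_cnt` with the numbers made variables. In practice (c) is a small
branch-and-bound tree whose leaves are Farkas combinations checked by `linarith` (4 leaves at `(11,36)`, 6 at `(7,23)`). Nothing on `ω`.
-/

namespace Summit.MatrixMultiplication.OmegaCensus.SmallFormats.Enum723

open Finset
open Summit.MatrixMultiplication.OmegaCensus.RankOnePlaneCapGeneral
open Literature.Computability.AlgebraicComplexity Matrix

/-- **Marginal ↦ count vector, generic `(n, r, C)`.** For a nowhere-zero `m ∈ XCaps3 n r` with at most `C` coefficient matrices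
orthogonal to each invertible `X₀`, the count vector `cnt m` satisfies the class-wise clauses (tensor g31's table `incL`). -/
theorem cnt_clauses {n r C : ℕ} (m : Fin r → Matrix (Fin 2) (Fin 2) (ZMod 3)) (hm : ∀ i, m i ≠ 0) (hX : XCaps3 n r m)
    (hcap : ∀ X₀ : Matrix (Fin 2) (Fin 2) (ZMod 3), X₀.det ≠ 0 →
      (Finset.univ.filter fun i => dotX (mflat (m i)) X₀ = 0).card ≤ C) :
    (∀ k, k < 32 → load (cnt m) k + 3 * n ≤ r) ∧ (∀ k, 32 ≤ k → k < 40 → load (cnt m) k + 6 * n ≤ 2 * r) ∧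
      (∀ k, 40 ≤ k → k < 58 → load (cnt m) k + 3 * n ≤ r) ∧ (∀ k, 58 ≤ k → k < 82 → load (cnt m) k ≤ C) ∧
      tot (cnt m) = r := by
  classical
  obtain ⟨-, -, -, hJ, hQ, hR, hC, -⟩ := hX
  refine ⟨fun k hk => ?_, fun k hk1 hk2 => ?_, fun k hk1 hk2 => ?_, fun k hk1 hk2 => ?_, tot_cnt m hm⟩
  · rw [← card_filter_csem m hm k (by omega)]
    have := hJ (jfin k)
    have e : (Finset.univ.filter fun i => csem k (mflat (m i))) =
        Finset.univ.filter fun i => perp3 (mflat (m i)) (jfin k) = true := by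
      congr 1; ext i; simp [csem, hk]
    rw [e]; omega
  · rw [← card_filter_csem m hm k (by omega)]
    have h1 : ¬ k < 32 := by omega
    by_cases h2 : k < 36
    · have hl := (hR (lamF (k - 32)) (lamF_ne _ (by omega))).1
      have e : (Finset.univ.filter fun i => csem k (mflat (m i))) =
          Finset.univ.filter fun i => Matrix.vecMul (lamF (k - 32)) (m i) = 0 := by
        congr 1; ext i; simp only [csem, if_neg h1, if_pos h2, vecMul_eq_zero_iff, mflat_apply]
      rw [e]; omega
    · have h3 : k < 40 := hk2
      have hl := (hC (lamF (k - 36)) (lamF_ne _ (by omega))).1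
      have e : (Finset.univ.filter fun i => csem k (mflat (m i))) =
          Finset.univ.filter fun i => Matrix.mulVec (m i) (lamF (k - 36)) = 0 := by
        congr 1; ext i; simp only [csem, if_neg h1, if_neg h2, if_pos h3, mulVec_eq_zero_iff, mflat_apply]
      rw [e]; omega
  · rw [← card_filter_csem m hm k (by omega)]
    have h1 : ¬ k < 32 := by omega
    have h2 : ¬ k < 36 := by omega
    have h3 : ¬ k < 40 := by omega
    have := hQ (qfin k)
    have e : (Finset.univ.filter fun i => csem k (mflat (m i))) =
        Finset.univ.filter fun i => perpQ3 (mflat (m i)) (qfin k) = true := by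
      congr 1; ext i; simp [csem, h1, h2, h3, hk2]
    rw [e]; omega
  · rw [← card_filter_csem m hm k hk2]
    have h1 : ¬ k < 32 := by omega
    have h2 : ¬ k < 36 := by omega
    have h3 : ¬ k < 40 := by omega
    have h4 : ¬ k < 58 := by omega
    have := hcap (linM (k - 58)) (linM_det _ (by omega))
    have e : (Finset.univ.filter fun i => csem k (mflat (m i))) =
        Finset.univ.filter fun i => dotX (mflat (m i)) (linM (k - 58)) = 0 := by
      congr 1; ext i; simp [csem, h1, h2, h3, h4, dotX_eq_pdot3]
    rw [e]; omega

/-- **The count-certificate pipeline.** If `r ≤ R_𝔽₃(⟨2,2,n⟩)` (kernel floor), `4r ≤ 11n + 2C + 1` (so the half law caps the invertible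
lines at `C`), and NO count vector satisfies the class-wise clauses with invertible cap `C` and total `r`, then `r + 1 ≤ R_𝔽₃(⟨2,2,n⟩)`. -/
theorem succ_le_tensorRank_22n_gf3_of_count_certificate (n r C : ℕ) (hr : r ≤ tensorRank (matMulTensor (ZMod 3) 2 2 n))
    (hC : 4 * r ≤ 11 * n + 2 * C + 1)
    (hno : ∀ c : ℕ → ℕ, (∀ k, k < 32 → load c k + 3 * n ≤ r) → (∀ k, 32 ≤ k → k < 40 → load c k + 6 * n ≤ 2 * r) →
      (∀ k, 40 ≤ k → k < 58 → load c k + 3 * n ≤ r) → (∀ k, 58 ≤ k → k < 82 → load c k ≤ C) → tot c = r → False) :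
    r + 1 ≤ tensorRank (matMulTensor (ZMod 3) 2 2 n) := by
  refine succ_le_tensorRank_22n_gf3_of_half_enumeration r hr ∅ ?_ (fun rep hrep => absurd hrep (by simp))
  intro m hm hX hhalf
  exfalso
  obtain ⟨hJ, hRC, hQ, hL, ht⟩ := cnt_clauses (C := C) m hm hX fun X₀ hX₀ => by have h := hhalf X₀ hX₀; omega
  exact hno (cnt m) hJ hRC hQ hL ht

/-- **`37 ≤ R_𝔽₃(⟨2,2,11⟩)` through the pipeline** (the certificate `no_adm1136` of `MatMul2211GF3Rank37` restated in pipeline form would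
be a duplicate; here only the reduction to a count certificate at `C = 11` is recorded). -/
theorem thirtyseven_le_tensorRank_2211_gf3_of_count_certificate
    (hno : ∀ c : ℕ → ℕ, (∀ k, k < 32 → load c k + 3 * 11 ≤ 36) → (∀ k, 32 ≤ k → k < 40 → load c k + 6 * 11 ≤ 2 * 36) →
      (∀ k, 40 ≤ k → k < 58 → load c k + 3 * 11 ≤ 36) → (∀ k, 58 ≤ k → k < 82 → load c k ≤ 11) → tot c = 36 → False) :
    37 ≤ tensorRank (matMulTensor (ZMod 3) 2 2 11) :=
  succ_le_tensorRank_22n_gf3_of_count_certificate 11 36 11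
    (by have h := (tensorRank_matMulTensor_22n_gf3_window 11 (by norm_num)).1; omega) (by norm_num) hno

end Summit.MatrixMultiplication.OmegaCensus.SmallFormats.Enum723
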